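import Summits.ValiantsHypothesis.ValiantsHypothesis.Theorems.DivisionGapPerDivisionHardStubSparseRigidCount

/-!
# Crux `DivisionGap.PerDivisionHard` (stmt-ValiantsHypothesis-5065), line `pair-descent-jss-endpoint` —
stub `stub_edgeExtraction`: a two-point top fibre contains an edge

`stub_edgeExtraction`: if all monomials of `h ∈ ℝ≥0[x_ij]` have the same degree and the top fibre
`F = supp (topComponent w h)` of a weight `w` has two elements, then some weight `w'` has a top
fibre `F' ⊆ F` with two distinct elements `p₁, p₂` which is SEGMENT-LIKE with respect to them:
every `p ∈ F'` agrees with `p₁` at every cell where `p₁` and `p₂` agree.  (Convex-geometrically: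
a face of dimension `≥ 1` of the Newton polytope contains an edge, and the lattice points of an
edge `[p₁, p_far]` are `p₁ + t (p_far - p₁)`.)

Proof (constructive, digit weights; everything is an explicit finite sum).
* Refinement (`mem_support_topComponent_refine`): for `M` exceeding all `δ`-weights on `supp h`,
  the top fibre of `M • w + δ` is the `δ`-argmax part of the top fibre of `w`.  By homogeneity an
  integer functional `Φ` shifted by a constant is an `ℕ`-weight with the same argmax
  (`weight_shift`), so it suffices to expose a segment-like subset of `F` by an integer functional
  (`exists_exposing_functional`).
* The vertex: `p₁ :=` the unique maximiser over `F` of the base-`(N₀+1)` value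
  `W p = Σ_e p e · (N₀+1)^{rank e}` (`N₀` the common degree bounds all entries, so digit vectors
  are determined by their value, `eq_of_sum_mul_pow_eq`); `S m := W p₁ - W m > 0` off `p₁`.
* The extreme ray: with a second, steep digit functional `ψ₁ = (A+1)^{rank}` put
  `T m := ψ₁ (m - p₁)` and let `m⋆` maximise the slope `T m / S m` over `F ∖ {p₁}`.  The functional
  `Φ := S m⋆ · ψ₁ + T m⋆ · ψ₀` satisfies `Φ (m - p₁) = S m⋆ T m - T m⋆ S m ≤ 0` on `F`, with equality
  exactly at `p₁` and on the slope maximisers (`exposed_segment`); for such `m` the cross vector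
  `S m⋆ (m - p₁) - S m (m⋆ - p₁)` has `ψ₁`-value `0` and entries bounded by `A = 2 W(p₁) N₀`, so
  it vanishes (signed digits in base `A + 1`, `int_digits_eq_zero`): `m - p₁` is a positive
  multiple of `m⋆ - p₁`, whence segment-likeness with `p₂ := m⋆`.
-/

noncomputable section

-- `Summit.ValiantsHypothesis.ValiantsHypothesis.…` is the tree's mandated single-conjunct layout
-- (Sub = Summit), so the duplicated namespace component is intended.
set_option linter.dupNamespace false

namespace Summit.ValiantsHypothesis.ValiantsHypothesis.Theorems.DivisionGapPerDivisionHard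

open MvPolynomial Literature.Computability.AlgebraicComplexity
open Summit.ValiantsHypothesis.ValiantsHypothesis.Theorems.ZeroOneTransfer.Negative
open scoped NNReal

/-! ### Digits -/

/-- Signed digits: if `|u i| ≤ A < B` for all `i` and `∑ i, u i * B ^ i = 0` then `u = 0`.
[folklore] -/
theorem int_digits_eq_zero {A B : ℤ} (hAB : A < B) :
    ∀ {K : ℕ} (u : Fin K → ℤ), (∀ i, |u i| ≤ A) →
      ∑ i, u i * B ^ (i : ℕ) = 0 → ∀ i, u i = 0 := by
  intro K
  induction K with
  | zero => intro u _ _ i; exact i.elim0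
  | succ K ih =>
    intro u hu h
    rw [Fin.sum_univ_succ] at h
    simp only [Fin.val_zero, pow_zero, mul_one, Fin.val_succ, pow_succ] at h
    have hre : ∑ i : Fin K, u i.succ * (B ^ (i : ℕ) * B) =
        B * ∑ i : Fin K, u i.succ * B ^ (i : ℕ) := by
      rw [Finset.mul_sum]
      exact Finset.sum_congr rfl fun i _ => by ring
    rw [hre] at h
    have hB : 0 < B := lt_of_le_of_lt ((abs_nonneg _).trans (hu 0)) hAB
    have hdvd : B ∣ u 0 := ⟨-∑ i : Fin K, u i.succ * B ^ (i : ℕ), by linear_combination h⟩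
    have h0 : u 0 = 0 := Int.eq_zero_of_abs_lt_dvd hdvd ((hu 0).trans_lt hAB)
    rw [h0, zero_add] at h
    have h1 : ∑ i : Fin K, u i.succ * B ^ (i : ℕ) = 0 :=
      (mul_eq_zero.mp h).resolve_left hB.ne'
    intro i
    refine Fin.cases h0 (fun j => ?_) i
    exact ih (fun j => u j.succ) (fun j => hu _) h1 j

/-- Signed digits along a ranking of a finite type. [folklore] -/
theorem int_digits_eq_zero_equiv {σ : Type*} [Fintype σ] {K : ℕ} (rank : σ ≃ Fin K) {A B : ℤ}
    (hAB : A < B) (u : σ → ℤ) (hu : ∀ e, |u e| ≤ A)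
    (h : ∑ e, u e * B ^ (rank e : ℕ) = 0) : ∀ e, u e = 0 := by
  have h' : ∑ i : Fin K, u (rank.symm i) * B ^ (i : ℕ) = 0 := by
    rw [← h]
    exact (Fintype.sum_equiv rank _ _ fun e => by simp).symm
  intro e
  have := int_digits_eq_zero hAB (fun i => u (rank.symm i)) (fun i => hu _) h' (rank e)
  simpa using this

/-- Base-`B` digit vectors along a ranking of a finite type are determined by their value.
[folklore] -/
theorem nat_digits_injective_equiv {σ : Type*} [Fintype σ] {K : ℕ} (rank : σ ≃ Fin K) {B : ℕ}
    (f g : σ → ℕ) (hf : ∀ e, f e < B) (hg : ∀ e, g e < B)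
    (h : ∑ e, f e * B ^ (rank e : ℕ) = ∑ e, g e * B ^ (rank e : ℕ)) : f = g := by
  have hre : ∀ u : σ → ℕ,
      ∑ e, u e * B ^ (rank e : ℕ) = ∑ i : Fin K, u (rank.symm i) * B ^ (i : ℕ) :=
    fun u => Fintype.sum_equiv rank _ _ fun e => by simp
  have key := eq_of_sum_mul_pow_eq (fun i => f (rank.symm i)) (fun i => g (rank.symm i))
    (fun i => hf _) (fun i => hg _) (by
      show ∑ i : Fin K, f (rank.symm i) * B ^ (i : ℕ) = ∑ i : Fin K, g (rank.symm i) * B ^ (i : ℕ)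
      rw [← hre, ← hre, h])
  funext e
  have := congrFun key (rank e)
  simpa using this

/-! ### Top fibres and their refinements -/

/-- Membership in the top fibre: a monomial of `h` of maximal weight. [folklore] -/
theorem mem_support_topComponent_iff {σ : Type*} (w : σ → ℕ) (h : MvPolynomial σ ℝ≥0)
    (d : σ →₀ ℕ) :
    d ∈ (topComponent w h).support ↔
      d ∈ h.support ∧ ∀ q ∈ h.support, Finsupp.weight w q ≤ Finsupp.weight w d := by
  rw [mem_support_iff, coeff_topComponent]
  constructor
  · intro hd
    by_cases hw : Finsupp.weight w d = weightedTotalDegree w h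
    · rw [if_pos hw] at hd
      refine ⟨mem_support_iff.mpr hd, fun q hq => ?_⟩
      rw [hw]
      exact le_weightedTotalDegree w hq
    · rw [if_neg hw] at hd
      exact absurd rfl hd
  · rintro ⟨hd, hmax⟩
    have hw : Finsupp.weight w d = weightedTotalDegree w h :=
      le_antisymm (le_weightedTotalDegree w hd) (Finset.sup_le hmax)
    rw [if_pos hw]
    exact mem_support_iff.mp hd

/-- `Finsupp.weight` is linear in the weight: `weight (M w + δ) = M weight w + weight δ`.
[folklore] -/
theorem weight_mul_add {σ : Type*} (M : ℕ) (w δ : σ → ℕ) (q : σ →₀ ℕ) :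
    Finsupp.weight (fun e => M * w e + δ e) q =
      M * Finsupp.weight w q + Finsupp.weight δ q := by
  simp only [Finsupp.weight_apply, Finsupp.sum, smul_eq_mul, Finset.mul_sum,
    ← Finset.sum_add_distrib]
  exact Finset.sum_congr rfl fun e _ => by ring

/-- Over a finite type the weight is a plain sum. [folklore] -/
theorem weight_eq_sum {σ : Type*} [Fintype σ] (δ : σ → ℕ) (q : σ →₀ ℕ) :
    Finsupp.weight δ q = ∑ e, q e * δ e := by
  rw [Finsupp.weight_apply, Finsupp.sum_fintype q (fun i c => c • δ i) (fun _ => zero_smul _ _)]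
  simp only [smul_eq_mul]

/-- **Refinement of a top fibre.**  For `M` exceeding every `δ`-weight on the support of `h`,
the top fibre of `M • w + δ` is the `δ`-argmax part of the top fibre of `w`. [folklore] -/
theorem mem_support_topComponent_refine {σ : Type*} (w δ : σ → ℕ) (h : MvPolynomial σ ℝ≥0)
    (M : ℕ) (hM : ∀ q ∈ h.support, Finsupp.weight δ q < M) (d : σ →₀ ℕ) :
    d ∈ (topComponent (fun e => M * w e + δ e) h).support ↔
      d ∈ (topComponent w h).support ∧
        ∀ q ∈ (topComponent w h).support, Finsupp.weight δ q ≤ Finsupp.weight δ d := by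
  simp only [mem_support_topComponent_iff, weight_mul_add]
  constructor
  · rintro ⟨hd, hmax⟩
    have hwd : ∀ q ∈ h.support, Finsupp.weight w q ≤ Finsupp.weight w d := by
      intro q hq
      by_contra hlt
      have h1 := hmax q hq
      have h2 := hM d hd
      have h3 : M * Finsupp.weight w d + M ≤ M * Finsupp.weight w q := by
        rw [← Nat.mul_succ]
        exact Nat.mul_le_mul_left M (not_le.mp hlt)
      omega
    refine ⟨⟨hd, hwd⟩, fun q hq => ?_⟩
    have h1 := hmax q hq.1
    have h2 : Finsupp.weight w q = Finsupp.weight w d := le_antisymm (hwd q hq.1) (hq.2 d hd)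
    rw [h2] at h1
    omega
  · rintro ⟨⟨hd, hwd⟩, hδ⟩
    refine ⟨hd, fun q hq => ?_⟩
    rcases (hwd q hq).lt_or_eq with hlt | heq
    · have h2 := hM q hq
      have h3 : M * Finsupp.weight w q + M ≤ M * Finsupp.weight w d := by
        rw [← Nat.mul_succ]
        exact Nat.mul_le_mul_left M hlt
      omega
    · rw [heq]
      have := hδ q ⟨hq, fun r hr => by rw [heq]; exact hwd r hr⟩
      omega

/-- An integer functional shifted by a constant to an `ℕ`-weight: the weight is the functional
plus the constant times the degree. [folklore] -/
theorem weight_shift {σ : Type*} [Fintype σ] (Φ : σ → ℤ) (K : ℤ) (δ : σ → ℕ)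
    (hδ : ∀ e, (δ e : ℤ) = Φ e + K) (p : σ →₀ ℕ) :
    (Finsupp.weight δ p : ℤ) = ∑ e, (p e : ℤ) * Φ e + K * p.degree := by
  rw [weight_eq_sum, Finsupp.degree_eq_sum, Nat.cast_sum, Nat.cast_sum, Finset.mul_sum,
    ← Finset.sum_add_distrib]
  refine Finset.sum_congr rfl fun e _ => ?_
  rw [Nat.cast_mul, hδ e]
  ring

/-! ### Exposing an edge -/

/-- **The exposing functional.**  Given the normalisations `S m > 0` (by `ψ₀`) and the steep values
`T m` (by `ψ₁`) of the directions `m - p₁`, a slope maximiser `m⋆` (`T m · S m⋆ ≤ T m⋆ · S m`)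
and genericity of `ψ₁` on the cross vectors, the functional `Φ = S m⋆ · ψ₁ + T m⋆ · ψ₀` is
maximised over `F` at `p₁` and `m⋆`, and its argmax is segment-like with respect to `(p₁, m⋆)`.
[folklore] -/
theorem exposed_segment {σ : Type*} [Fintype σ] (F : Finset (σ →₀ ℕ)) (ψ₀ ψ₁ Φ : σ → ℤ)
    (p₁ mS : σ →₀ ℕ) (hmS : mS ∈ F) (hmSne : mS ≠ p₁) (S T : (σ →₀ ℕ) → ℤ)
    (hS : ∀ m, S m = ∑ e, ((p₁ e : ℤ) - m e) * ψ₀ e)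
    (hT : ∀ m, T m = ∑ e, ((m e : ℤ) - p₁ e) * ψ₁ e)
    (hΦ : ∀ e, Φ e = S mS * ψ₁ e + T mS * ψ₀ e)
    (hSpos : ∀ m ∈ F, m ≠ p₁ → 0 < S m)
    (hcross : ∀ m ∈ F, m ≠ p₁ → T m * S mS ≤ T mS * S m)
    (hsep : ∀ m ∈ F, m ≠ p₁ →
      ∑ e, (S mS * ((m e : ℤ) - p₁ e) - S m * ((mS e : ℤ) - p₁ e)) * ψ₁ e = 0 →
      ∀ e, S mS * ((m e : ℤ) - p₁ e) = S m * ((mS e : ℤ) - p₁ e)) :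
    (∀ q ∈ F, ∑ e, (q e : ℤ) * Φ e ≤ ∑ e, (p₁ e : ℤ) * Φ e) ∧
    (∑ e, (p₁ e : ℤ) * Φ e ≤ ∑ e, (mS e : ℤ) * Φ e) ∧
    ∀ p ∈ F, ∑ e, (p₁ e : ℤ) * Φ e ≤ ∑ e, (p e : ℤ) * Φ e →
      ∀ e, p₁ e = mS e → p e = p₁ e := by
  -- the key identity `Φ (m - p₁) = S m⋆ · T m - T m⋆ · S m`
  have key : ∀ m : σ →₀ ℕ, ∑ e, (m e : ℤ) * Φ e - ∑ e, (p₁ e : ℤ) * Φ e =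
      S mS * T m - T mS * S m := by
    intro m
    rw [hT m, hS m, Finset.mul_sum, Finset.mul_sum, ← Finset.sum_sub_distrib,
      ← Finset.sum_sub_distrib]
    refine Finset.sum_congr rfl fun e _ => ?_
    rw [hΦ e]
    ring
  refine ⟨fun q hq => ?_, ?_, fun p hp hle e he => ?_⟩
  · by_cases hq1 : q = p₁
    · rw [hq1]
    · have h1 := key q
      have h2 := hcross q hq hq1
      linarith
  · have h1 := key mS
    linarith
  · by_cases hp1 : p = p₁
    · rw [hp1]
    · have h1 := key p
      have h2 := hcross p hp hp1
      have heq : S mS * T p = T mS * S p := by linarith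
      have hv : ∑ e, (S mS * ((p e : ℤ) - p₁ e) - S p * ((mS e : ℤ) - p₁ e)) * ψ₁ e = 0 := by
        have h3 : ∑ e, (S mS * ((p e : ℤ) - p₁ e) - S p * ((mS e : ℤ) - p₁ e)) * ψ₁ e =
            S mS * T p - S p * T mS := by
          rw [hT p, hT mS, Finset.mul_sum, Finset.mul_sum, ← Finset.sum_sub_distrib]
          exact Finset.sum_congr rfl fun e _ => by ring
        rw [h3]
        linarith
      have h3 := hsep p hp hp1 hv e
      have h4 : (mS e : ℤ) - p₁ e = 0 := by rw [he, sub_self]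
      rw [h4, mul_zero] at h3
      have h5 := (mul_eq_zero.mp h3).resolve_left (hSpos mS hmS hmSne).ne'
      exact_mod_cast (sub_eq_zero.mp h5 : (p e : ℤ) = p₁ e)

/-- **A finite set of bounded exponent vectors with two elements has an edge exposed by an integer
functional**: some `Φ : σ → ℤ` is maximised over `F` at two distinct points `p₁, p₂`, and every
maximiser agrees with `p₁` wherever `p₁` and `p₂` agree. [folklore] -/
theorem exists_exposing_functional {σ : Type*} [Fintype σ] (F : Finset (σ →₀ ℕ)) (N₀ : ℕ)
    (hN : ∀ p ∈ F, ∀ e, p e ≤ N₀) {m₁ m₂ : σ →₀ ℕ} (hm₁ : m₁ ∈ F) (hm₂ : m₂ ∈ F)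
    (hne : m₁ ≠ m₂) :
    ∃ (Φ : σ → ℤ) (p₁ p₂ : σ →₀ ℕ), p₁ ∈ F ∧ p₂ ∈ F ∧ p₁ ≠ p₂ ∧
      (∀ q ∈ F, ∑ e, (q e : ℤ) * Φ e ≤ ∑ e, (p₁ e : ℤ) * Φ e) ∧
      (∑ e, (p₁ e : ℤ) * Φ e ≤ ∑ e, (p₂ e : ℤ) * Φ e) ∧
      ∀ p ∈ F, ∑ e, (p₁ e : ℤ) * Φ e ≤ ∑ e, (p e : ℤ) * Φ e →
        ∀ e, p₁ e = p₂ e → p e = p₁ e := by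
  classical
  -- a ranking of the coordinates
  obtain ⟨rank⟩ : Nonempty (σ ≃ Fin (Fintype.card σ)) := ⟨Fintype.equivFin σ⟩
  -- STEP 1: the vertex `p₁`, the unique maximiser over `F` of the base-`(N₀ + 1)` value `W`
  obtain ⟨W, hW⟩ : ∃ W : (σ →₀ ℕ) → ℕ, ∀ p, W p = ∑ e, p e * (N₀ + 1) ^ (rank e : ℕ) :=
    ⟨_, fun _ => rfl⟩
  have hWinj : ∀ p ∈ F, ∀ q ∈ F, W p = W q → p = q := by
    intro p hp q hq hpq
    rw [hW, hW] at hpq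
    exact Finsupp.ext fun e => congrFun (nat_digits_injective_equiv rank p q
      (fun e => Nat.lt_add_one_iff.mpr (hN p hp e)) (fun e => Nat.lt_add_one_iff.mpr (hN q hq e))
      hpq) e
  obtain ⟨p₁, hp₁, hmax₁⟩ := F.exists_max_image W ⟨m₁, hm₁⟩
  have hlt : ∀ m ∈ F, m ≠ p₁ → W m < W p₁ := fun m hm hmne =>
    lt_of_le_of_ne (hmax₁ m hm) fun h => hmne (hWinj m hm p₁ hp₁ h)
  obtain ⟨m₀, hm₀, hm₀ne⟩ : ∃ m₀ ∈ F, m₀ ≠ p₁ := by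
    by_cases h : m₁ = p₁
    · exact ⟨m₂, hm₂, fun h' => hne (h.trans h'.symm)⟩
    · exact ⟨m₁, hm₁, h⟩
  -- STEP 2: the two functionals, the normalisations `S m > 0` and the steep values `T m`
  set A : ℕ := 2 * W p₁ * N₀ with hA
  obtain ⟨ψ₀, hψ₀⟩ : ∃ ψ₀ : σ → ℤ, ∀ e, ψ₀ e = ((N₀ + 1 : ℕ) : ℤ) ^ (rank e : ℕ) :=
    ⟨_, fun _ => rfl⟩
  obtain ⟨ψ₁, hψ₁⟩ : ∃ ψ₁ : σ → ℤ, ∀ e, ψ₁ e = ((A : ℤ) + 1) ^ (rank e : ℕ) :=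
    ⟨_, fun _ => rfl⟩
  obtain ⟨S, hS⟩ : ∃ S : (σ →₀ ℕ) → ℤ, ∀ m, S m = ∑ e, ((p₁ e : ℤ) - m e) * ψ₀ e :=
    ⟨_, fun _ => rfl⟩
  obtain ⟨T, hT⟩ : ∃ T : (σ →₀ ℕ) → ℤ, ∀ m, T m = ∑ e, ((m e : ℤ) - p₁ e) * ψ₁ e :=
    ⟨_, fun _ => rfl⟩
  have hSW : ∀ m, S m = (W p₁ : ℤ) - W m := by
    intro m
    rw [hS, hW, hW, Nat.cast_sum, Nat.cast_sum, ← Finset.sum_sub_distrib]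
    refine Finset.sum_congr rfl fun e _ => ?_
    rw [hψ₀]
    push_cast
    ring
  have hSpos : ∀ m ∈ F, m ≠ p₁ → 0 < S m := fun m hm hmne => by
    rw [hSW]
    have := hlt m hm hmne
    omega
  have hSle : ∀ m, S m ≤ W p₁ := fun m => by
    rw [hSW]
    omega
  have hD : ∀ q ∈ F, ∀ e, |(q e : ℤ) - p₁ e| ≤ N₀ := by
    intro q hq e
    have h1 := hN q hq e
    have h2 := hN p₁ hp₁ e
    rw [abs_le]
    constructor <;> omega
  -- the slope maximiser `mS` over `F \ {p₁}`
  obtain ⟨mS, hmS', hmaxS⟩ := (F.erase p₁).exists_max_image (fun m => (T m : ℚ) / (S m : ℚ))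
    ⟨m₀, Finset.mem_erase.mpr ⟨hm₀ne, hm₀⟩⟩
  obtain ⟨hmSne, hmS⟩ := Finset.mem_erase.mp hmS'
  have hcross : ∀ m ∈ F, m ≠ p₁ → T m * S mS ≤ T mS * S m := by
    intro m hm hmne
    have h1 : (T m : ℚ) / S m ≤ (T mS : ℚ) / S mS := hmaxS m (Finset.mem_erase.mpr ⟨hmne, hm⟩)
    rw [div_le_div_iff₀ (Int.cast_pos.mpr (hSpos m hm hmne))
      (Int.cast_pos.mpr (hSpos mS hmS hmSne))] at h1
    exact_mod_cast h1
  -- genericity of `ψ₁` on the cross vectors: signed digits `≤ A` in base `A + 1`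
  have hsep : ∀ m ∈ F, m ≠ p₁ →
      ∑ e, (S mS * ((m e : ℤ) - p₁ e) - S m * ((mS e : ℤ) - p₁ e)) * ψ₁ e = 0 →
      ∀ e, S mS * ((m e : ℤ) - p₁ e) = S m * ((mS e : ℤ) - p₁ e) := by
    intro m hm hmne hsum e
    have hbound : ∀ e, |S mS * ((m e : ℤ) - p₁ e) - S m * ((mS e : ℤ) - p₁ e)| ≤ (A : ℤ) := by
      intro e
      have h1 : |S mS * ((m e : ℤ) - p₁ e)| ≤ W p₁ * N₀ := by
        rw [abs_mul, abs_of_pos (hSpos mS hmS hmSne)]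
        exact mul_le_mul (hSle mS) (hD m hm e) (abs_nonneg _) (Nat.cast_nonneg _)
      have h2 : |S m * ((mS e : ℤ) - p₁ e)| ≤ W p₁ * N₀ := by
        rw [abs_mul, abs_of_pos (hSpos m hm hmne)]
        exact mul_le_mul (hSle m) (hD mS hmS e) (abs_nonneg _) (Nat.cast_nonneg _)
      rw [hA]
      push_cast
      rw [abs_le] at h1 h2 ⊢
      constructor <;> linarith [h1.1, h1.2, h2.1, h2.2]
    have key := int_digits_eq_zero_equiv rank (lt_add_one (A : ℤ)) _ hbound
      (by simpa only [hψ₁] using hsum) e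
    exact sub_eq_zero.mp key
  -- STEPS 3-4: the exposing functional and the segment
  obtain ⟨Φ, hΦ⟩ : ∃ Φ : σ → ℤ, ∀ e, Φ e = S mS * ψ₁ e + T mS * ψ₀ e := ⟨_, fun _ => rfl⟩
  obtain ⟨h1, h2, h3⟩ :=
    exposed_segment F ψ₀ ψ₁ Φ p₁ mS hmS hmSne S T hS hT hΦ hSpos hcross hsep
  exact ⟨Φ, p₁, mS, hp₁, hmS, fun h => hmSne h.symm, h1, h2, h3⟩

/-! ### The stub -/

/-- **`stub_edgeExtraction`.**  A top fibre of a polynomial all of whose monomials have the same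
degree, if it has two elements, contains an EDGE: there is a weight `w'` whose top fibre lies
inside the given one, has two distinct elements `p₁, p₂`, and is segment-like with respect to
them (every element agrees with `p₁` wherever `p₁` and `p₂` agree).  Expose an edge of the fibre
by an integer functional (`exists_exposing_functional`), shift it by a constant to an `ℕ`-weight
`δ` (harmless by homogeneity, `weight_shift`) and refine `w` to `M • w + δ`
(`mem_support_topComponent_refine`). [folklore] -/
theorem stub_edgeExtraction :
    ∀ (n : ℕ) (h : MvPolynomial (Fin n × Fin n) ℝ≥0) (w : Fin n × Fin n → ℕ)
      (m₁ m₂ : (Fin n × Fin n) →₀ ℕ),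
      (∀ p₁ ∈ h.support, ∀ p₂ ∈ h.support, p₁.degree = p₂.degree) →
      m₁ ∈ (topComponent w h).support → m₂ ∈ (topComponent w h).support → m₁ ≠ m₂ →
      ∃ (w' : Fin n × Fin n → ℕ) (p₁ p₂ : (Fin n × Fin n) →₀ ℕ),
        (topComponent w' h).support ⊆ (topComponent w h).support ∧
        p₁ ∈ (topComponent w' h).support ∧ p₂ ∈ (topComponent w' h).support ∧ p₁ ≠ p₂ ∧
        ∀ p ∈ (topComponent w' h).support, ∀ e, p₁ e = p₂ e → p e = p₁ e := by
  intro n h w m₁ m₂ hdeg hm₁ hm₂ hne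
  have hFsub : (topComponent w h).support ⊆ h.support := support_topComponent_subset w h
  have hN : ∀ p ∈ (topComponent w h).support, ∀ e, p e ≤ m₁.degree := fun p hp e =>
    (Finsupp.le_degree e p).trans (hdeg p (hFsub hp) m₁ (hFsub hm₁)).le
  obtain ⟨Φ, p₁, p₂, hp₁, hp₂, hne₁₂, hmax, hp₂max, hseg⟩ :=
    exists_exposing_functional _ _ hN hm₁ hm₂ hne
  -- shift `Φ` by a constant to an `ℕ`-weight `δ`
  have hK : ∀ e, 0 ≤ Φ e + ∑ e', |Φ e'| := fun e => by
    have h1 : |Φ e| ≤ ∑ e', |Φ e'| :=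
      Finset.single_le_sum (fun e' _ => abs_nonneg (Φ e')) (Finset.mem_univ e)
    have h2 := neg_abs_le (Φ e)
    linarith
  obtain ⟨δ, hδ⟩ : ∃ δ : Fin n × Fin n → ℕ, ∀ e, (δ e : ℤ) = Φ e + ∑ e', |Φ e'| :=
    ⟨fun e => (Φ e + ∑ e', |Φ e'|).toNat, fun e => Int.toNat_of_nonneg (hK e)⟩
  have hδw : ∀ p ∈ (topComponent w h).support, (Finsupp.weight δ p : ℤ) =
      ∑ e, (p e : ℤ) * Φ e + (∑ e', |Φ e'|) * ((m₁.degree : ℕ) : ℤ) := by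
    intro p hp
    rw [weight_shift Φ _ δ hδ p, hdeg p (hFsub hp) m₁ (hFsub hm₁)]
  have hcmp : ∀ p ∈ (topComponent w h).support, ∀ q ∈ (topComponent w h).support,
      Finsupp.weight δ q ≤ Finsupp.weight δ p ↔
        ∑ e, (q e : ℤ) * Φ e ≤ ∑ e, (p e : ℤ) * Φ e := by
    intro p hp q hq
    rw [← Nat.cast_le (α := ℤ), hδw p hp, hδw q hq]
    exact add_le_add_iff_right _
  -- refine `w` by `δ`
  obtain ⟨M, hM⟩ : ∃ M : ℕ, ∀ q ∈ h.support, Finsupp.weight δ q < M :=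
    ⟨h.support.sup (fun q => Finsupp.weight δ q) + 1, fun q hq =>
      Nat.lt_add_one_iff.mpr (Finset.le_sup (f := fun q => Finsupp.weight δ q) hq)⟩
  have hmem := mem_support_topComponent_refine w δ h M hM
  refine ⟨fun e => M * w e + δ e, p₁, p₂, fun d hd => ((hmem d).mp hd).1, ?_, ?_, hne₁₂, ?_⟩
  · exact (hmem p₁).mpr ⟨hp₁, fun q hq => (hcmp p₁ hp₁ q hq).mpr (hmax q hq)⟩
  · exact (hmem p₂).mpr ⟨hp₂, fun q hq => (hcmp p₂ hp₂ q hq).mpr ((hmax q hq).trans hp₂max)⟩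
  · intro p hp e he
    obtain ⟨hpF, hpmax⟩ := (hmem p).mp hp
    exact hseg p hpF ((hcmp p hpF p₁ hp₁).mp (hpmax p₁ hp₁)) e he

end Summit.ValiantsHypothesis.ValiantsHypothesis.Theorems.DivisionGapPerDivisionHard

end
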